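import Literature.Analysis.FluidPDE.SphereReflectionPushforward
import Literature.MathematicalPhysics.KineticTheory.EntropyProductionIntegrable
import HarnessLib

/-!
# The hard-sphere entropy production in the `σ`-representation

Stage 1 (first half) of the entropy–entropy-production programme for `HardSphereEEP`
(Rezakhanlou–Villani, *Entropy Methods for the Boltzmann Equation*, LNM 1916 (2008), Ch. 1 §1.4.2).

The tree's entropy production `Literature.Analysis.FluidPDE.entropyProduction hardSphereKernel f` is
written in the impact-direction (`ω`-) representation, `v' = v - ⟨v - v_*, ν⟩ ν` with kernel
`⟨v - v_*, ν⟩₊ dν`. Villani's lemmas are written in the `σ`-representation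
`v' = (v + v_*)/2 + |v - v_*| σ/2` (`sigmaCollide`), in which the angular average of `f(v') f(v_*')`
over the collision sphere is manifestly a function of `(v + v_*, |v|² + |v_*|²)`. This file passes
from one to the other:

* `sigmaCollide_reflect`: `σ-collide (a - 2⟪a,ν⟫ν) p = collide ν p`, `a = (v - v_*)/|v - v_*|`;
* `lintegral_hardSphereKernel_mul_comp_collide`: for measurable `Θ ≥ 0`,
  `∫∫∫ ⟨z,ν⟩₊ Θ(collide ν p, p) dν dp = ∫∫ |z| · ¼ ∫_{S²} Θ(σ-collide s p, p) ds dp`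
  (Tonelli and the reflection pushforward `lintegral_toSphere_cos_mul_comp_reflect`): the tree's
  kernel corresponds to `B(z, σ) dσ = (|z|/4) dσ` (Villani 2002 Ch. 1 §1.4: for hard spheres the
  `σ`-kernel is constant in the angle);
* `epPair`, `epPair_nonneg`: the pair functional `J(p', p) = (F' - F) log (F'/F) ≥ 0`;
* `entropyProduction_hardSphere_sigmaRep`: `D(f) = ¼ ∫∫ |z| · ¼ ∫_{S²} J(σ-collide s p, p) ds dp`
  for positive measurable `f` (extended integral; the Bochner `D(f)` is its real part).
-/

noncomputable section

open scoped BigOperators ENNReal Topology InnerProductSpace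
open MeasureTheory Set Metric Real

namespace Literature.MathematicalPhysics.KineticTheory

open Literature.Analysis.FluidPDE (entropyProduction)

/-- The **`σ`-parametrisation of a hard-sphere collision**: for incoming velocities `p = (v, v_*)` and a
direction `s` (a unit vector), the outgoing pair
`σ-collide s (v, v_*) = ((v + v_*)/2 + (|v - v_*|/2) s, (v + v_*)/2 - (|v - v_*|/2) s)`
(Villani 2002 Ch. 1 §1.4; Cercignani–Illner–Pulvirenti 1994 §3.1). Defined for every `s ∈ ℝ³`;
for unit `s` it ranges over the collision sphere (momentum and energy are conserved). [folklore] -/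
def sigmaCollide (s : V3) (p : V3 × V3) : V3 × V3 :=
  ((2 : ℝ)⁻¹ • (p.1 + p.2) + (‖p.1 - p.2‖ / 2) • s, (2 : ℝ)⁻¹ • (p.1 + p.2) - (‖p.1 - p.2‖ / 2) • s)

/-- `sigmaCollide` is continuous in `(s, p)`. [folklore] -/
theorem continuous_sigmaCollide : Continuous (fun q : V3 × (V3 × V3) => sigmaCollide q.1 q.2) := by
  unfold sigmaCollide; fun_prop

/-- **`ω`- versus `σ`-parametrisation**: with `z = v - v_*`, `a = z/|z|` and impact direction `ν`,
the reflected direction `σ = a - 2⟪a, ν⟫ ν` gives back the `ω`-representation collision law: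
`σ-collide (a - 2⟪a,ν⟫ν) (v, v_*) = collide ν (v, v_*)` (also when `z = 0`, both sides being `(v, v)`).
[folklore] -/
theorem sigmaCollide_reflect (ν : sphere (0 : V3) 1) (p : V3 × V3) :
    sigmaCollide (‖p.1 - p.2‖⁻¹ • (p.1 - p.2) -
        (2 * ⟪‖p.1 - p.2‖⁻¹ • (p.1 - p.2), (ν : V3)⟫_ℝ) • (ν : V3)) p = collide ν p := by
  obtain ⟨v, w⟩ := p
  dsimp only
  rcases eq_or_ne (v - w) 0 with hz | hz
  · have hvw : v = w := sub_eq_zero.1 hz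
    subst hvw
    simp only [sigmaCollide, collide, sub_self, norm_zero, inv_zero, zero_smul, inner_zero_left,
      mul_zero, sub_zero, add_zero, smul_zero, Prod.mk.injEq]
    constructor <;> module
  · have hn : ‖v - w‖ ≠ 0 := norm_ne_zero_iff.2 hz
    have hc' : ‖v - w‖ * ⟪‖v - w‖⁻¹ • (v - w), (ν : V3)⟫_ℝ = ⟪v - w, (ν : V3)⟫_ℝ := by
      rw [real_inner_smul_left, ← mul_assoc, mul_inv_cancel₀ hn, one_mul]
    have key : (‖v - w‖ / 2) • (‖v - w‖⁻¹ • (v - w) -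
        (2 * ⟪‖v - w‖⁻¹ • (v - w), (ν : V3)⟫_ℝ) • (ν : V3)) =
        (2 : ℝ)⁻¹ • (v - w) - ⟪v - w, (ν : V3)⟫_ℝ • (ν : V3) := by
      rw [smul_sub, smul_smul, smul_smul, show ‖v - w‖ / 2 * ‖v - w‖⁻¹ = 2⁻¹ by field_simp,
        show ‖v - w‖ / 2 * (2 * ⟪‖v - w‖⁻¹ • (v - w), (ν : V3)⟫_ℝ) =
          ‖v - w‖ * ⟪‖v - w‖⁻¹ • (v - w), (ν : V3)⟫_ℝ by ring, hc']
    simp only [sigmaCollide, collide]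
    rw [key, Prod.mk.injEq]
    constructor <;> module

/-- The hard-sphere kernel factors through the unit relative velocity:
`ofReal ((z·ν)₊) = ofReal |z| · ofReal ⟪z/|z|, ν⟫` in `ℝ≥0∞`. [folklore] -/
theorem ofReal_hardSphereKernel (p : V3 × V3) (ν : sphere (0 : V3) 1) :
    ENNReal.ofReal (hardSphereKernel p ν) =
      ENNReal.ofReal ‖p.1 - p.2‖ * ENNReal.ofReal ⟪‖p.1 - p.2‖⁻¹ • (p.1 - p.2), (ν : V3)⟫_ℝ := by
  unfold hardSphereKernel
  rcases eq_or_ne (p.1 - p.2) 0 with hz | hz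
  · simp [hz]
  · have hn : 0 < ‖p.1 - p.2‖ := norm_pos_iff.2 hz
    rw [inner_smul_left, RCLike.conj_to_real, ← ENNReal.ofReal_mul hn.le, ← mul_assoc,
      mul_inv_cancel₀ hn.ne', one_mul]
    rcases le_or_gt ⟪p.1 - p.2, (ν : V3)⟫_ℝ 0 with h | h
    · rw [max_eq_right h, ENNReal.ofReal_zero, ENNReal.ofReal_eq_zero.2 h]
    · rw [max_eq_left h.le]

/-- **The hard-sphere collision integral in the `σ`-representation** (Tonelli + the reflection
pushforward `lintegral_toSphere_cos_mul_comp_reflect` with `a = (v - v_*)/|v - v_*|`): for measurable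
`Θ ≥ 0` on (outgoing pair, incoming pair),
`∫∫∫ (z·ν)₊ Θ(collide ν p, p) dν dv dv_* = ∫∫ |v - v_*| · ¼ ∫_{S²} Θ(σ-collide s p, p) ds dv dv_*`,
i.e. `B(z, ν) dν = (z·ν)₊ dν` corresponds to the constant-in-angle kernel `B(z, σ) dσ = (|z|/4) dσ`
(Villani 2002 Ch. 1 §1.4; Rezakhanlou–Villani 2008 Ch. 1 §1.1). [folklore] -/
theorem lintegral_hardSphereKernel_mul_comp_collide (Θ : V3 × V3 → V3 × V3 → ℝ≥0∞)
    (hΘ : Measurable (Function.uncurry Θ)) :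
    ∫⁻ q : (V3 × V3) × sphere (0 : V3) 1,
        ENNReal.ofReal (hardSphereKernel q.1 q.2) * Θ (collide q.2 q.1) q.1
          ∂(((volume : Measure V3).prod volume).prod sphereMeasure) =
      ∫⁻ p : V3 × V3, ENNReal.ofReal ‖p.1 - p.2‖ *
          (4⁻¹ * ∫⁻ s : sphere (0 : V3) 1, Θ (sigmaCollide s p) p ∂sphereMeasure)
        ∂((volume : Measure V3).prod volume) := by
  haveI : IsFiniteMeasure (sphereMeasure (E := V3)) := by unfold sphereMeasure; infer_instance
  have hG : Measurable fun q : (V3 × V3) × sphere (0 : V3) 1 =>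
      ENNReal.ofReal (hardSphereKernel q.1 q.2) * Θ (collide q.2 q.1) q.1 := by
    refine (UkaiLanford.continuous_hardSphereKernel_uncurry.measurable.ennreal_ofReal).mul ?_
    exact hΘ.comp ((Literature.Analysis.FluidPDE.continuous_collide_uncurry (E := V3)).measurable.prodMk
      measurable_fst)
  rw [lintegral_prod _ hG.aemeasurable]
  refine lintegral_congr fun p => ?_
  set z := p.1 - p.2 with hz
  set a : V3 := ‖z‖⁻¹ • z with ha
  set φ : V3 → ℝ≥0∞ := fun s => Θ (sigmaCollide s p) p with hφ
  have hφm : Measurable φ :=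
    hΘ.comp ((continuous_sigmaCollide.comp (continuous_id.prodMk continuous_const)).measurable.prodMk
      measurable_const)
  have hpt : ∀ ν : sphere (0 : V3) 1,
      ENNReal.ofReal (hardSphereKernel p ν) * Θ (collide ν p) p =
        ENNReal.ofReal ‖z‖ * (ENNReal.ofReal ⟪a, (ν : V3)⟫_ℝ * φ (a - (2 * ⟪a, (ν : V3)⟫_ℝ) • (ν : V3))) := by
    intro ν
    rw [ofReal_hardSphereKernel, ← sigmaCollide_reflect ν p, mul_assoc]
  simp_rw [hpt]
  rw [lintegral_const_mul' _ _ ENNReal.ofReal_ne_top]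
  rcases eq_or_ne z 0 with h0 | h0
  · simp [h0]
  · have ha1 : ‖a‖ = 1 := by
      rw [ha, norm_smul, norm_inv, norm_norm, inv_mul_cancel₀ (norm_ne_zero_iff.2 h0)]
    congr 1
    exact Literature.Analysis.FluidPDE.lintegral_toSphere_cos_mul_comp_reflect ha1 hφm

/-- The pair functional of the entropy production: `J(p', p) = (F(p') - F(p)) log (F(p')/F(p))`,
`F(v, v_*) = f(v) f(v_*)` (nonnegative whenever `f > 0`). [folklore] -/
def epPair (f : V3 → ℝ) (p' p : V3 × V3) : ℝ :=
  (f p'.1 * f p'.2 - f p.1 * f p.2) * log (f p'.1 * f p'.2 / (f p.1 * f p.2))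

/-- `epIntegrand f q = (z·ν)₊ · J(collide ν p, p)`. [folklore] -/
theorem epIntegrand_eq (f : V3 → ℝ) (q : (V3 × V3) × sphere (0 : V3) 1) :
    epIntegrand f q = hardSphereKernel q.1 q.2 * epPair f (collide q.2 q.1) q.1 := rfl

/-- `J(p', p) ≥ 0` for positive `f` (`(X - Y) log (X/Y) ≥ 0`). [folklore] -/
theorem epPair_nonneg {f : V3 → ℝ} (hpos : ∀ v, 0 < f v) (p' p : V3 × V3) : 0 ≤ epPair f p' p := by
  unfold epPair
  set X := f p'.1 * f p'.2
  set Y := f p.1 * f p.2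
  have hX : 0 < X := mul_pos (hpos _) (hpos _)
  have hY : 0 < Y := mul_pos (hpos _) (hpos _)
  rcases le_total Y X with h | h
  · exact mul_nonneg (sub_nonneg.2 h) (Real.log_nonneg ((one_le_div hY).2 h))
  · exact mul_nonneg_of_nonpos_of_nonpos (sub_nonpos.2 h)
      (Real.log_nonpos (div_pos hX hY).le ((div_le_one hY).2 h))

/-- **The hard-sphere entropy production in the `σ`-representation**: for measurable positive `f`,
`D(f) = ¼ ∫∫ |v - v_*| · ¼ ∫_{S²} J(σ-collide s p, p) ds dv dv_*` (as an extended integral; the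
Bochner `D(f)` is its real part, `0` if infinite), with `J(p',p) = (F' - F) log (F'/F)`
(Rezakhanlou–Villani 2008, Ch. 1 §1.4.2, `D(f) = ¼ ∫ (f'f'_* - ff_*) log (f'f'_*/(ff_*)) B dσ dv dv_*`
with `B = |v - v_*|/4` for the tree's kernel). [cite: RezakhanlouVillani2008, Ch. 1 §1.4.2 p. 28] -/
theorem entropyProduction_hardSphere_sigmaRep {f : V3 → ℝ} (hf : Measurable f) (hpos : ∀ v, 0 < f v) :
    entropyProduction hardSphereKernel f =
      4⁻¹ * (∫⁻ p : V3 × V3, ENNReal.ofReal ‖p.1 - p.2‖ *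
          (4⁻¹ * ∫⁻ s : sphere (0 : V3) 1, ENNReal.ofReal (epPair f (sigmaCollide s p) p)
            ∂sphereMeasure) ∂((volume : Measure V3).prod volume)).toReal := by
  rw [entropyProduction_eq_integral_epIntegrand]
  congr 1
  have hJm : Measurable (Function.uncurry fun p' p : V3 × V3 => ENNReal.ofReal (epPair f p' p)) := by
    unfold epPair Function.uncurry
    apply Measurable.ennreal_ofReal
    have h1 : Measurable fun x : (V3 × V3) × (V3 × V3) => f x.1.1 := hf.comp (by fun_prop)
    have h2 : Measurable fun x : (V3 × V3) × (V3 × V3) => f x.1.2 := hf.comp (by fun_prop)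
    have h3 : Measurable fun x : (V3 × V3) × (V3 × V3) => f x.2.1 := hf.comp (by fun_prop)
    have h4 : Measurable fun x : (V3 × V3) × (V3 × V3) => f x.2.2 := hf.comp (by fun_prop)
    exact ((h1.mul h2).sub (h3.mul h4)).mul (((h1.mul h2).div (h3.mul h4)).log)
  have hIm : Measurable (epIntegrand f : (V3 × V3) × sphere (0 : V3) 1 → ℝ) := by
    have hc := (Literature.Analysis.FluidPDE.continuous_collide_uncurry (E := V3)).measurable
    have h1 : Measurable fun q : (V3 × V3) × sphere (0 : V3) 1 => f (collide q.2 q.1).1 :=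
      hf.comp (measurable_fst.comp hc)
    have h2 : Measurable fun q : (V3 × V3) × sphere (0 : V3) 1 => f (collide q.2 q.1).2 :=
      hf.comp (measurable_snd.comp hc)
    have h3 : Measurable fun q : (V3 × V3) × sphere (0 : V3) 1 => f q.1.1 := hf.comp (by fun_prop)
    have h4 : Measurable fun q : (V3 × V3) × sphere (0 : V3) 1 => f q.1.2 := hf.comp (by fun_prop)
    unfold epIntegrand
    exact UkaiLanford.continuous_hardSphereKernel_uncurry.measurable.mul
      (((h1.mul h2).sub (h3.mul h4)).mul (((h1.mul h2).div (h3.mul h4)).log))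
  rw [integral_eq_lintegral_of_nonneg_ae (Filter.Eventually.of_forall fun q => ?_)
      hIm.aestronglyMeasurable]
  · congr 1
    rw [← lintegral_hardSphereKernel_mul_comp_collide _ hJm]
    refine lintegral_congr fun q => ?_
    rw [epIntegrand_eq, ENNReal.ofReal_mul]
    unfold hardSphereKernel
    exact le_max_right _ _
  · rw [Pi.zero_apply, epIntegrand_eq]
    exact mul_nonneg (by unfold hardSphereKernel; exact le_max_right _ _) (epPair_nonneg hpos _ _)


end Literature.MathematicalPhysics.KineticTheory

end
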